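import Literature.MathematicalPhysics.QuantumManyBody.BoseGasDirichletMonotonicity
import HarnessLib

/-!
# Weighted group extraction with particle `0` frozen (`stub_weightedGroupFloor`)

Crux `stmt-AtomisticToContinuum-13034` (`RigidMomentumBound`, route `BECTangentRigidity`), line
`registered`, stub `stub_weightedGroupFloor` (brick F2 of the local virial route): for an
admissible `Φ` of `N + 1` bosons in the Dirichlet box `Λ_L` and ANY measurable weight
`wt : ℝ³ → [0, ∞]` of the position of particle `0`, the kinetic energy of the particles `1, …, N`
plus their mutual interaction, weighted by `wt(x₀)`, is at least `E₀(N, L)` times the weighted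
mass:
`E₀(N, L) ∫ wt(x₀) |Φ|² ≤ ∫ wt(x₀) (∑_{i ≥ 1} |∇ᵢΦ|² + ∑_{1 ≤ i < j} v(|xᵢ - xⱼ|) |Φ|²)`.

Proof. For an indicator weight `wt = 1_S` this is the Dirichlet group extraction inequality
`groundStateEnergy_mul_le_setLIntegral_group` of
`Literature/…/BoseGasDirichletMonotonicity.lean` with the group `ι = Fin.succ` (particles
`1, …, N`, UNCONSTRAINED inside the same box: `u = 0`, `ℓ = L`), the only particle outside the
group being particle `0`, constrained to `S`. The passage from indicator weights to a general
measurable weight is the monotone class argument (`Measurable.ennreal_induction`): both sides are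
lower Lebesgue integrals of `wt(x₀) ×` a fixed nonnegative measurable density, hence additive in
`wt` and continuous along increasing sequences (monotone convergence), and `E₀ · (−)` commutes with
suprema in `[0, ∞]` (`ENNReal.mul_iSup`, also when `E₀ = ⊤`).
-/

noncomputable section

namespace Summit.AtomisticToContinuum.BoseEinsteinCondensation.Theorems.RigidMomentumBound

open MeasureTheory Filter Set
open scoped ENNReal NNReal BigOperators
open Literature.MathematicalPhysics.QuantumManyBody.BoseGas

namespace WeightedGroupFloor

/-- Integrating a multiple of an indicator weight composed with a measurable map `π` against a
measurable density `G`: `∫ c·1_S(π x) G(x) = c ∫_{π ⁻¹ S} G`. [folklore] -/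
theorem lintegral_indicator_comp_mul {Ω α : Type*} [MeasurableSpace Ω] [MeasurableSpace α]
    {μ : Measure Ω} {π : Ω → α} (hπ : Measurable π) {G : Ω → ℝ≥0∞} (hG : Measurable G)
    (c : ℝ≥0∞) {s : Set α} (hs : MeasurableSet s) :
    ∫⁻ x, s.indicator (fun _ => c) (π x) * G x ∂μ = c * ∫⁻ x in π ⁻¹' s, G x ∂μ := by
  rw [← lintegral_const_mul c hG, ← lintegral_indicator (hs.preimage hπ)]
  refine lintegral_congr fun x => ?_
  by_cases hx : π x ∈ s
  · rw [indicator_of_mem hx, indicator_of_mem (show x ∈ π ⁻¹' s from hx)]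
  · rw [indicator_of_notMem hx, indicator_of_notMem (show x ∉ π ⁻¹' s from hx), zero_mul]

/-- **From level sets to weights (monotone class step).** Let `π : Ω → α` be measurable, `M, F`
nonnegative measurable densities on `Ω` and `E ∈ [0, ∞]`. If `E ∫_{π ⁻¹ S} M ≤ ∫_{π ⁻¹ S} F` for
every measurable `S ⊆ α`, then `E ∫ wt(π x) M(x) ≤ ∫ wt(π x) F(x)` for every measurable weight
`wt : α → [0, ∞]`: indicators are the hypothesis, both sides are additive in `wt`, and monotone
convergence together with `E · sup = sup E ·` in `[0, ∞]` passes to increasing limits of simple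
functions. [folklore] -/
theorem mul_lintegral_comp_mul_le {Ω α : Type*} [MeasurableSpace Ω] [MeasurableSpace α]
    {μ : Measure Ω} {π : Ω → α} (hπ : Measurable π) {M F : Ω → ℝ≥0∞} (hM : Measurable M)
    (hF : Measurable F) (E : ℝ≥0∞)
    (hset : ∀ S : Set α, MeasurableSet S →
      E * ∫⁻ x in π ⁻¹' S, M x ∂μ ≤ ∫⁻ x in π ⁻¹' S, F x ∂μ)
    {wt : α → ℝ≥0∞} (hwt : Measurable wt) :
    E * ∫⁻ x, wt (π x) * M x ∂μ ≤ ∫⁻ x, wt (π x) * F x ∂μ := by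
  refine Measurable.ennreal_induction (motive := fun wt =>
    E * ∫⁻ x, wt (π x) * M x ∂μ ≤ ∫⁻ x, wt (π x) * F x ∂μ) ?_ ?_ ?_ hwt
  · -- indicators: the set version
    intro c S hS
    rw [lintegral_indicator_comp_mul hπ hM c hS, lintegral_indicator_comp_mul hπ hF c hS,
      ← mul_assoc, mul_comm E c, mul_assoc]
    exact mul_le_mul_right (hset S hS) c
  · -- additivity
    intro f g _ hf hg hPf hPg
    have hfM : Measurable fun x => f (π x) * M x := (hf.comp hπ).mul hM
    have hfF : Measurable fun x => f (π x) * F x := (hf.comp hπ).mul hF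
    simp only [Pi.add_apply, add_mul]
    rw [lintegral_add_left hfM, lintegral_add_left hfF, mul_add]
    exact add_le_add hPf hPg
  · -- increasing limits (monotone convergence)
    intro f hf hmono hP
    have hmM : Monotone fun n x => f n (π x) * M x :=
      fun m n hmn x => mul_le_mul_left (hmono hmn (π x)) (M x)
    have hmF : Monotone fun n x => f n (π x) * F x :=
      fun m n hmn x => mul_le_mul_left (hmono hmn (π x)) (F x)
    have hfM : ∀ n, Measurable fun x => f n (π x) * M x := fun n => ((hf n).comp hπ).mul hM
    have hfF : ∀ n, Measurable fun x => f n (π x) * F x := fun n => ((hf n).comp hπ).mul hF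
    simp only [ENNReal.iSup_mul]
    rw [lintegral_iSup hfM hmM, lintegral_iSup hfF hmF, ENNReal.mul_iSup]
    exact iSup_mono fun n => hP n

/-- **The set version.** For an admissible `Φ` of `N + 1` bosons in the box `Λ_L` and any set `S`
of positions of particle `0`: on `{x₀ ∈ S}` the kinetic energy of the group `1, …, N` plus its
internal interaction is at least `E₀(N, L)` times the mass there — the Dirichlet group
extraction inequality with `ι = Fin.succ`, `u = 0`, `ℓ = L` (the group never leaves the box
because `Φ` vanishes off `Λ_L^{N+1}`; its permutations, extended by the identity on particle `0`,
are Bose symmetries of `Φ`). [cite: LSSY2005, (2.52)–(2.53)] -/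
theorem groundStateEnergy_mul_setLIntegral_fst_le {v : ℝ → ℝ≥0∞} (hv : Measurable v) {N : ℕ}
    {L : ℝ} (Φ : TrialState (N + 1) L) (S : Set Space) :
    groundStateEnergy v N L *
        ∫⁻ X in (fun X : Config (N + 1) => X 0) ⁻¹' S, (‖Φ.ψ X‖₊ : ℝ≥0∞) ^ 2 ≤
      ∫⁻ X in (fun X : Config (N + 1) => X 0) ⁻¹' S,
        kineticOn (Fin.succEmb N) Φ.ψ X +
          interactionOn (Fin.succEmb N) v X * (‖Φ.ψ X‖₊ : ℝ≥0∞) ^ 2 := by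
  have h0 : (0 : Fin (N + 1)) ∉ Set.range (Fin.succEmb N) := by
    rintro ⟨i, hi⟩
    exact Fin.succ_ne_zero i hi
  have hsupp : ∀ X : Config (N + 1), (∃ i, X (Fin.succEmb N i) - 0 ∉ box L) → Φ.ψ X = 0 := by
    rintro X ⟨i, hi⟩
    rw [sub_zero] at hi
    exact Φ.eq_zero X fun hX => hi (hX _)
  exact groundStateEnergy_mul_le_setLIntegral_group (Fin.succEmb N) 0 L hv Φ.contDiff
    (fun _ X => Φ.symm _ X) hsupp {Z | Z ⟨0, h0⟩ ∈ S}

end WeightedGroupFloor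

open WeightedGroupFloor

/-- **`stub_weightedGroupFloor` — weighted group extraction with particle `0` frozen.** For a
measurable pair potential `v`, an admissible `Φ` of `N + 1` bosons in the Dirichlet box `Λ_L`
and any measurable weight `wt ≥ 0` of the position of particle `0`, the kinetic energy of the
particles `1, …, N` plus their mutual interaction, weighted by `wt(x₀)`, is at least `E₀(N, L)`
times the weighted mass `∫ wt(x₀)|Φ|²` (the group `1, …, N` is unconstrained in the same box, so
no artificial boundary appears). Proof: the set version
`groundStateEnergy_mul_setLIntegral_fst_le` (`groundStateEnergy_mul_le_setLIntegral_group` with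
`ι = Fin.succ`, `u = 0`, `ℓ = L`) and the monotone class argument in the weight
(`mul_lintegral_comp_mul_le`). [cite: LSSY2005, (2.52)–(2.53)] -/
theorem stub_weightedGroupFloor :
    ∀ (v : ℝ → ℝ≥0∞), Measurable v → ∀ {N : ℕ} {L : ℝ} (Φ : TrialState (N + 1) L)
      (wt : Space → ℝ≥0∞), Measurable wt →
      groundStateEnergy v N L * ∫⁻ X, wt (X 0) * (‖Φ.ψ X‖₊ : ℝ≥0∞) ^ 2 ≤
        ∫⁻ X, wt (X 0) *
          (∑ i : Fin N, ∑ k : Fin 3,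
              (‖fderiv ℝ Φ.ψ X (Pi.single i.succ (EuclideanSpace.single k (1 : ℝ)))‖₊ : ℝ≥0∞) ^ 2 +
            interaction v (fun i : Fin N => X i.succ) * (‖Φ.ψ X‖₊ : ℝ≥0∞) ^ 2) := by
  intro v hv N L Φ wt hwt
  change groundStateEnergy v N L * ∫⁻ X, wt (X 0) * (‖Φ.ψ X‖₊ : ℝ≥0∞) ^ 2 ≤
    ∫⁻ X, wt (X 0) * (kineticOn (Fin.succEmb N) Φ.ψ X +
      interactionOn (Fin.succEmb N) v X * (‖Φ.ψ X‖₊ : ℝ≥0∞) ^ 2)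
  exact mul_lintegral_comp_mul_le (μ := volume) (π := fun X : Config (N + 1) => X 0)
    (measurable_pi_apply 0) (measurable_normSq Φ.contDiff.continuous)
    ((measurable_kineticOn _ Φ.contDiff).add
      ((measurable_interactionOn _ hv).mul (measurable_normSq Φ.contDiff.continuous)))
    (groundStateEnergy v N L)
    (fun S _ => groundStateEnergy_mul_setLIntegral_fst_le hv Φ S) hwt

end Summit.AtomisticToContinuum.BoseEinsteinCondensation.Theorems.RigidMomentumBound

end
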